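import Summits.RiemannHypothesis.RiemannHypothesis.Theses.IntegerScrew
import Literature.NumberTheory.LFunctions.ZetaScrewThm17Proofs
import HarnessLib

/-!
# Line `split-landau` for crux `IntegerScrew.DiscreteLandau` (stmt-RiemannHypothesis-15758)

`DiscreteLandau : (∀ m ≥ 1, Ψ(log m) ≥ 0) → RH`, `Ψ = zetaScrew` (Suzuki2023 (1.1)).

The crux-strategist's BC2 REDIRECT (2026-08-17): `DiscreteLandau` is the assembly of THREE RH-free
pieces — the children of the prepared split (`children.json`, glue `DiscreteLandauOfSubs`, kernel-checked
standalone module `IntegerScrewDiscreteLandauSplit.lean` attached as evidence):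

* P1 `ScrewNodeInterpolation` — integer → real interpolation: `∃ K, ∀ t ≥ 0, Ψ(log ⌊e^t⌋) - K ≤ Ψ(t)`
  (stubs `stub_cellDrop`, `stub_cellBudget`; composition `ScrewNodeInterpolation_of`);
* P2 `ScrewLaplaceAbscissa` — Landau push: `Ψ` bounded below on `[0,∞)` ⇒ `∫_0^∞ |Ψ(t)| e^{-σt} dt < ∞`
  for every `σ > 0` (stubs `stub_slackMellin`, `stub_landauPush`, `stub_unshift`; `ScrewLaplaceAbscissa_of`);
* P3 `ScrewLaplaceDetection` — sign-free detection: absolute convergence on `Re s > 0` ⇒ RH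
  (stubs `stub_xiContinuation`, `stub_rh_of_continuation`; `ScrewLaplaceDetection_of`);

and `DiscreteLandau_of` composes the seven stub STATEMENTS into the crux BY NAME
(`Summit.RiemannHypothesis.RiemannHypothesis.Theses.IntegerScrew.DiscreteLandau`), sorry-free; the final
`discreteLandau` shows the file proves the crux modulo exactly the `stub_*` sorries.

Engine: the tree's PROVED Thm 1.7 sufficiency (`ZetaScrewThm17Proofs.lean`, namespace `ZetaScrewLandau`:
`mellinIoi_eq_of_re_gt`, `integrableOn_zetaScrew_log_iff`, `integrableOn_zetaScrew_log_rpow`,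
`riemannXi_half_add_ofReal_ne_zero`, `differentiableAt_R`; `Landau.integrableOn_of_differentiableOn_union_convex`,
`Landau.differentiableOn_mellinIoi_of_forall`; `ZetaScrewThm17.zetaScrewPrimeSum_eq_affine`), rerun with the
constant slack `K` (Mellin `K/s`, pole at `0`, left of every Landau rectangle) and with the positivity step
separated from the detection step. Until the split is materialised the three pieces are LOCAL defs below,
verbatim the `children.json` statements.
-/

namespace Summit.RiemannHypothesis.RiemannHypothesis.Cruxes.DiscreteLandau.SplitLandau

open Literature.NumberTheory.LFunctions

/-! ## The three pieces (verbatim the prepared children of `DiscreteLandau`) -/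

/-- P1 — node interpolation (child `ScrewNodeInterpolation`). -/
def ScrewNodeInterpolation : Prop :=
  ∃ K : ℝ, ∀ t : ℝ, 0 ≤ t → Literature.NumberTheory.LFunctions.zetaScrew (Real.log (⌊Real.exp t⌋₊ : ℕ)) - K ≤ Literature.NumberTheory.LFunctions.zetaScrew t

/-- P2 — Landau push (child `ScrewLaplaceAbscissa`). -/
def ScrewLaplaceAbscissa : Prop :=
  (∃ K : ℝ, ∀ t : ℝ, 0 ≤ t → -K ≤ Literature.NumberTheory.LFunctions.zetaScrew t) → ∀ σ : ℝ, 0 < σ → MeasureTheory.IntegrableOn (fun t : ℝ => Literature.NumberTheory.LFunctions.zetaScrew t * Real.exp (-σ * t)) (Set.Ioi 0)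

/-- P3 — sign-free detection (child `ScrewLaplaceDetection`). -/
def ScrewLaplaceDetection : Prop :=
  (∀ σ : ℝ, 0 < σ → MeasureTheory.IntegrableOn (fun t : ℝ => Literature.NumberTheory.LFunctions.zetaScrew t * Real.exp (-σ * t)) (Set.Ioi 0)) → RiemannHypothesis

/-! ## The seven stub statements as named propositions `Sig.stub_*` (the skeleton audit matches the
hypotheses of `DiscreteLandau_of` against these BY NAME) -/

namespace Sig

/-- P1a statement. -/
def stub_cellDrop : Prop :=
  ∀ t : ℝ, 0 ≤ t →
    Literature.NumberTheory.LFunctions.zetaScrew (Real.log (⌊Real.exp t⌋₊ : ℕ))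
        - Literature.NumberTheory.LFunctions.zetaScrew t ≤
      ((∑ n ∈ Finset.Icc 1 ⌊Real.exp t⌋₊, ArithmeticFunction.vonMangoldt n / Real.sqrt n)
          + (Real.eulerMascheroniConstant + Real.pi / 2 + 3 * Real.log 2 + Real.log Real.pi) / 2)
        * (t - Real.log (⌊Real.exp t⌋₊ : ℕ))

/-- P1b statement. -/
def stub_cellBudget : Prop :=
  ∃ K : ℝ, ∀ t : ℝ, 0 ≤ t →
    ((∑ n ∈ Finset.Icc 1 ⌊Real.exp t⌋₊, ArithmeticFunction.vonMangoldt n / Real.sqrt n)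
        + (Real.eulerMascheroniConstant + Real.pi / 2 + 3 * Real.log 2 + Real.log Real.pi) / 2)
      * (t - Real.log (⌊Real.exp t⌋₊ : ℕ)) ≤ K

/-- P2a statement. -/
def stub_slackMellin : Prop :=
  ∀ (K : ℝ) (s : ℂ), 1 < s.re →
    Literature.NumberTheory.LFunctions.Landau.mellinIoi
        (fun x : ℝ => Literature.NumberTheory.LFunctions.zetaScrew (Real.log x) + K) s =
      1 / s ^ 2 * logDeriv Literature.NumberTheory.LFunctions.riemannXi (1 / 2 + s) + (K : ℂ) / s

/-- P2b statement. -/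
def stub_landauPush : Prop :=
  ∀ K : ℝ,
    (∀ x : ℝ, 1 < x → 0 ≤ Literature.NumberTheory.LFunctions.zetaScrew (Real.log x) + K) →
    (∀ s : ℂ, 1 < s.re →
      Literature.NumberTheory.LFunctions.Landau.mellinIoi
          (fun x : ℝ => Literature.NumberTheory.LFunctions.zetaScrew (Real.log x) + K) s =
        1 / s ^ 2 * logDeriv Literature.NumberTheory.LFunctions.riemannXi (1 / 2 + s) + (K : ℂ) / s) →
    ∀ σ : ℝ, 0 < σ → MeasureTheory.IntegrableOn
      (fun x : ℝ => (Literature.NumberTheory.LFunctions.zetaScrew (Real.log x) + K) * x ^ (-(σ + 1)))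
      (Set.Ioi 1)

/-- P2c statement. -/
def stub_unshift : Prop :=
  ∀ (K σ : ℝ), 0 < σ →
    MeasureTheory.IntegrableOn
      (fun x : ℝ => (Literature.NumberTheory.LFunctions.zetaScrew (Real.log x) + K) * x ^ (-(σ + 1)))
      (Set.Ioi 1) →
    MeasureTheory.IntegrableOn
      (fun t : ℝ => Literature.NumberTheory.LFunctions.zetaScrew t * Real.exp (-σ * t)) (Set.Ioi 0)

/-- P3a statement. -/
def stub_xiContinuation : Prop :=
  (∀ σ : ℝ, 0 < σ → MeasureTheory.IntegrableOn
    (fun t : ℝ => Literature.NumberTheory.LFunctions.zetaScrew t * Real.exp (-σ * t)) (Set.Ioi 0)) →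
  ∃ F : ℂ → ℂ, DifferentiableOn ℂ F {s : ℂ | 0 < s.re} ∧
    Set.EqOn (fun s : ℂ => F s * s ^ 2 * Literature.NumberTheory.LFunctions.riemannXi (1 / 2 + s))
      (fun s : ℂ => deriv Literature.NumberTheory.LFunctions.riemannXi (1 / 2 + s))
      {s : ℂ | 0 < s.re}

/-- P3b statement. -/
def stub_rh_of_continuation : Prop :=
  (∃ F : ℂ → ℂ, DifferentiableOn ℂ F {s : ℂ | 0 < s.re} ∧
    Set.EqOn (fun s : ℂ => F s * s ^ 2 * Literature.NumberTheory.LFunctions.riemannXi (1 / 2 + s))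
      (fun s : ℂ => deriv Literature.NumberTheory.LFunctions.riemannXi (1 / 2 + s))
      {s : ℂ | 0 < s.re}) →
  RiemannHypothesis

end Sig

/-! ## P1: node interpolation -/

/-- STUB (P1a, the structural step; M). Inside the floor cell `log m ≤ t < log(m+1)`, `m = ⌊e^t⌋`,
the screw function drops below its node value by at most `(S(m) + c₀/2)(t - log m)`,
`S(m) = Σ_{n ≤ m} Λ(n)/√n`, `c₀ = γ + π/2 + 3 log 2 + log π`: the prime sum is affine with slope
`S(m)` on the cell (`ZetaScrewThm17.zetaScrewPrimeSum_eq_affine`), `4(e^{t/2} + e^{-t/2} - 2)` is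
increasing on `t ≥ 0`, and `-¼ e^{-t/2} Φ(e^{-2t},2,¼) = -¼ Σ_k e^{-t(2k+1/2)}/(k+¼)²` is increasing
(termwise, `summable_hurwitzLerchQuarter`). -/
theorem stub_cellDrop : ∀ t : ℝ, 0 ≤ t →
    Literature.NumberTheory.LFunctions.zetaScrew (Real.log (⌊Real.exp t⌋₊ : ℕ))
        - Literature.NumberTheory.LFunctions.zetaScrew t ≤
      ((∑ n ∈ Finset.Icc 1 ⌊Real.exp t⌋₊, ArithmeticFunction.vonMangoldt n / Real.sqrt n)
          + (Real.eulerMascheroniConstant + Real.pi / 2 + 3 * Real.log 2 + Real.log Real.pi) / 2)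
        * (t - Real.log (⌊Real.exp t⌋₊ : ℕ)) := by
  sorry

/-- STUB (P1b, the arithmetic step; S–M). The cell budget is bounded: `t - log ⌊e^t⌋ ≤
log(1 + 1/m) ≤ 1/m` and `S(m) ≤ 2m` (`Λ(n) ≤ log n ≤ 2√n`, `ArithmeticFunction.vonMangoldt_le_log`,
`Real.log_le_rpow_div`), `c₀/2 < 2.7`, so `K = 5` works. -/
theorem stub_cellBudget : ∃ K : ℝ, ∀ t : ℝ, 0 ≤ t →
    ((∑ n ∈ Finset.Icc 1 ⌊Real.exp t⌋₊, ArithmeticFunction.vonMangoldt n / Real.sqrt n)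
        + (Real.eulerMascheroniConstant + Real.pi / 2 + 3 * Real.log 2 + Real.log Real.pi) / 2)
      * (t - Real.log (⌊Real.exp t⌋₊ : ℕ)) ≤ K := by
  sorry

/-- COMPOSITION of P1 from its two stubs (sorry-free). -/
theorem ScrewNodeInterpolation_of
    (hdrop : ∀ t : ℝ, 0 ≤ t →
      Literature.NumberTheory.LFunctions.zetaScrew (Real.log (⌊Real.exp t⌋₊ : ℕ))
          - Literature.NumberTheory.LFunctions.zetaScrew t ≤
        ((∑ n ∈ Finset.Icc 1 ⌊Real.exp t⌋₊, ArithmeticFunction.vonMangoldt n / Real.sqrt n)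
            + (Real.eulerMascheroniConstant + Real.pi / 2 + 3 * Real.log 2 + Real.log Real.pi) / 2)
          * (t - Real.log (⌊Real.exp t⌋₊ : ℕ)))
    (hbud : ∃ K : ℝ, ∀ t : ℝ, 0 ≤ t →
      ((∑ n ∈ Finset.Icc 1 ⌊Real.exp t⌋₊, ArithmeticFunction.vonMangoldt n / Real.sqrt n)
          + (Real.eulerMascheroniConstant + Real.pi / 2 + 3 * Real.log 2 + Real.log Real.pi) / 2)
        * (t - Real.log (⌊Real.exp t⌋₊ : ℕ)) ≤ K) :
    ScrewNodeInterpolation := by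
  obtain ⟨K, hK⟩ := hbud
  refine ⟨K, fun t ht => ?_⟩
  have h1 := hdrop t ht
  have h2 := hK t ht
  linarith

/-! ## P2: Landau push -/

/-- STUB (P2a; S–M). Mellin transform of the shifted function: for `Re s > 1`,
`∫_1^∞ (Ψ(log x) + K) x^{-(s+1)} dx = s⁻²(ξ'/ξ)(1/2 + s) + K/s`
(`ZetaScrewLandau.mellinIoi_eq_of_re_gt` + `∫_1^∞ x^{-(s+1)} dx = 1/s`, linearity under the
integrability `integrableOn_zetaScrew_log_rpow`). -/
theorem stub_slackMellin : ∀ (K : ℝ) (s : ℂ), 1 < s.re →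
    Literature.NumberTheory.LFunctions.Landau.mellinIoi
        (fun x : ℝ => Literature.NumberTheory.LFunctions.zetaScrew (Real.log x) + K) s =
      1 / s ^ 2 * logDeriv Literature.NumberTheory.LFunctions.riemannXi (1 / 2 + s) + (K : ℂ) / s := by
  sorry

/-- STUB (P2b, the Landau step; M). If `g(x) = Ψ(log x) + K ≥ 0` on `(1, ∞)` and its transform is
`Φ(s) = s⁻²(ξ'/ξ)(1/2+s) + K/s` on `Re s > 1`, then `∫_1^∞ g(x) x^{-(σ+1)} dx` converges absolutely for
EVERY `σ > 0`: for `ε = min(σ/2, 1/2)` take a thin convex rectangle `W₀ ⊃ [ε/2, 3]` free of zeros of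
`ξ(1/2 + ·)` (`riemannXi_half_add_ofReal_ne_zero`, `IsCompact.exists_thickening_subset_open`); `Φ` is
holomorphic on `{Re s > 1} ∪ W₀` (`differentiableAt_R`; `K/s` has its only pole at `0 ∉ W₀`), so
`Landau.integrableOn_of_differentiableOn_union_convex` (σ₁ = 1, a = ε, X₁ = 1) applies — verbatim
the tree's `riemannXi_ne_zero_of_zetaScrew_nonneg`, first half. -/
theorem stub_landauPush : ∀ K : ℝ,
    (∀ x : ℝ, 1 < x → 0 ≤ Literature.NumberTheory.LFunctions.zetaScrew (Real.log x) + K) →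
    (∀ s : ℂ, 1 < s.re →
      Literature.NumberTheory.LFunctions.Landau.mellinIoi
          (fun x : ℝ => Literature.NumberTheory.LFunctions.zetaScrew (Real.log x) + K) s =
        1 / s ^ 2 * logDeriv Literature.NumberTheory.LFunctions.riemannXi (1 / 2 + s) + (K : ℂ) / s) →
    ∀ σ : ℝ, 0 < σ → MeasureTheory.IntegrableOn
      (fun x : ℝ => (Literature.NumberTheory.LFunctions.zetaScrew (Real.log x) + K) * x ^ (-(σ + 1)))
      (Set.Ioi 1) := by
  sorry

/-- STUB (P2c; S). Removing the slack and changing variables: `K x^{-(σ+1)}` is integrable on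
`(1, ∞)` for `σ > 0` (`integrableOn_Ioi_rpow_of_lt`), and `Ψ(log x) x^{-(σ+1)} ∈ L¹(1,∞)` iff
`Ψ(t) e^{-σt} ∈ L¹(0,∞)` (`ZetaScrewLandau.integrableOn_zetaScrew_log_iff`). -/
theorem stub_unshift : ∀ (K σ : ℝ), 0 < σ →
    MeasureTheory.IntegrableOn
      (fun x : ℝ => (Literature.NumberTheory.LFunctions.zetaScrew (Real.log x) + K) * x ^ (-(σ + 1)))
      (Set.Ioi 1) →
    MeasureTheory.IntegrableOn
      (fun t : ℝ => Literature.NumberTheory.LFunctions.zetaScrew t * Real.exp (-σ * t)) (Set.Ioi 0) := by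
  sorry

/-- COMPOSITION of P2 from its three stubs (sorry-free): positivity of `Ψ(log x) + K` on `(1, ∞)`
is the hypothesis of P2 at `t = log x ≥ 0`. -/
theorem ScrewLaplaceAbscissa_of
    (hM : ∀ (K : ℝ) (s : ℂ), 1 < s.re →
      Literature.NumberTheory.LFunctions.Landau.mellinIoi
          (fun x : ℝ => Literature.NumberTheory.LFunctions.zetaScrew (Real.log x) + K) s =
        1 / s ^ 2 * logDeriv Literature.NumberTheory.LFunctions.riemannXi (1 / 2 + s) + (K : ℂ) / s)
    (hL : ∀ K : ℝ,
      (∀ x : ℝ, 1 < x → 0 ≤ Literature.NumberTheory.LFunctions.zetaScrew (Real.log x) + K) →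
      (∀ s : ℂ, 1 < s.re →
        Literature.NumberTheory.LFunctions.Landau.mellinIoi
            (fun x : ℝ => Literature.NumberTheory.LFunctions.zetaScrew (Real.log x) + K) s =
          1 / s ^ 2 * logDeriv Literature.NumberTheory.LFunctions.riemannXi (1 / 2 + s) + (K : ℂ) / s) →
      ∀ σ : ℝ, 0 < σ → MeasureTheory.IntegrableOn
        (fun x : ℝ => (Literature.NumberTheory.LFunctions.zetaScrew (Real.log x) + K) * x ^ (-(σ + 1)))
        (Set.Ioi 1))
    (hU : ∀ (K σ : ℝ), 0 < σ →
      MeasureTheory.IntegrableOn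
        (fun x : ℝ => (Literature.NumberTheory.LFunctions.zetaScrew (Real.log x) + K) * x ^ (-(σ + 1)))
        (Set.Ioi 1) →
      MeasureTheory.IntegrableOn
        (fun t : ℝ => Literature.NumberTheory.LFunctions.zetaScrew t * Real.exp (-σ * t)) (Set.Ioi 0)) :
    ScrewLaplaceAbscissa := by
  intro h σ hσ
  obtain ⟨K, hK⟩ := h
  have hpos : ∀ x : ℝ, 1 < x → 0 ≤ Literature.NumberTheory.LFunctions.zetaScrew (Real.log x) + K := by
    intro x hx
    have := hK (Real.log x) (Real.log_pos hx).le
    linarith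
  exact hU K σ hσ (hL K hpos (hM K) σ hσ)

/-! ## P3: sign-free detection -/

/-- STUB (P3a, continuation; M). If `∫_0^∞ |Ψ(t)| e^{-σt} dt < ∞` for every `σ > 0`, then there is
`F` holomorphic on `Re s > 0` (namely `F = Landau.mellinIoi (Ψ ∘ log)`,
`Landau.differentiableOn_mellinIoi_of_forall` + `integrableOn_zetaScrew_log_iff`) with
`F(s) s² ξ(1/2 + s) = ξ'(1/2 + s)` on the whole half-plane (identity theorem from `Re s > 1`, where
`F = s⁻² ξ'/ξ(1/2+s)` by `mellinIoi_eq_of_re_gt` and `ξ ≠ 0`). -/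
theorem stub_xiContinuation :
    (∀ σ : ℝ, 0 < σ → MeasureTheory.IntegrableOn
      (fun t : ℝ => Literature.NumberTheory.LFunctions.zetaScrew t * Real.exp (-σ * t)) (Set.Ioi 0)) →
    ∃ F : ℂ → ℂ, DifferentiableOn ℂ F {s : ℂ | 0 < s.re} ∧
      Set.EqOn (fun s : ℂ => F s * s ^ 2 * Literature.NumberTheory.LFunctions.riemannXi (1 / 2 + s))
        (fun s : ℂ => deriv Literature.NumberTheory.LFunctions.riemannXi (1 / 2 + s))
        {s : ℂ | 0 < s.re} := by
  sorry

/-- STUB (P3b, order argument + functional equation; M). A holomorphic `F` on `Re s > 0` with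
`F s² · ξ(1/2+·) = ξ'(1/2+·)` there forces `ξ(1/2 + w₀) ≠ 0` for `Re w₀ > 0` (at a zero,
`ord ξ' + 1 = ord ξ ≤ ord ξ'` unless `ξ ≡ 0`: `AnalyticAt.analyticOrderAt_deriv_add_one`,
`analyticOrderAt_mul`), hence no zeros of `ζ` with `1/2 < Re s < 1` (`riemannXi_eq_zero_iff_holds`),
which is RH (`quasiRiemannHypothesis_one_half_iff_holds`) — verbatim the tree's
`riemannXi_ne_zero_of_zetaScrew_nonneg`, second half, and `riemannHypothesis_of_zetaScrew_nonneg`. -/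
theorem stub_rh_of_continuation :
    (∃ F : ℂ → ℂ, DifferentiableOn ℂ F {s : ℂ | 0 < s.re} ∧
      Set.EqOn (fun s : ℂ => F s * s ^ 2 * Literature.NumberTheory.LFunctions.riemannXi (1 / 2 + s))
        (fun s : ℂ => deriv Literature.NumberTheory.LFunctions.riemannXi (1 / 2 + s))
        {s : ℂ | 0 < s.re}) →
    RiemannHypothesis := by
  sorry

/-- COMPOSITION of P3 from its two stubs (sorry-free). -/
theorem ScrewLaplaceDetection_of
    (hC : (∀ σ : ℝ, 0 < σ → MeasureTheory.IntegrableOn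
        (fun t : ℝ => Literature.NumberTheory.LFunctions.zetaScrew t * Real.exp (-σ * t)) (Set.Ioi 0)) →
      ∃ F : ℂ → ℂ, DifferentiableOn ℂ F {s : ℂ | 0 < s.re} ∧
        Set.EqOn (fun s : ℂ => F s * s ^ 2 * Literature.NumberTheory.LFunctions.riemannXi (1 / 2 + s))
          (fun s : ℂ => deriv Literature.NumberTheory.LFunctions.riemannXi (1 / 2 + s))
          {s : ℂ | 0 < s.re})
    (hR : (∃ F : ℂ → ℂ, DifferentiableOn ℂ F {s : ℂ | 0 < s.re} ∧
        Set.EqOn (fun s : ℂ => F s * s ^ 2 * Literature.NumberTheory.LFunctions.riemannXi (1 / 2 + s))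
          (fun s : ℂ => deriv Literature.NumberTheory.LFunctions.riemannXi (1 / 2 + s))
          {s : ℂ | 0 < s.re}) →
      RiemannHypothesis) :
    ScrewLaplaceDetection :=
  fun hint => hR (hC hint)

/-! ## Composition to the crux BY NAME -/

/-- The seven stub STATEMENTS imply the crux `IntegerScrew.DiscreteLandau` (sorry-free; the glue is
the kernel-checked `discreteLandau_of_subs`: for `t ≥ 0` the node `⌊e^t⌋ ≥ 1`, so the crux
hypothesis and P1 give `Ψ ≥ -K` on `[0, ∞)`, P2 gives absolute convergence on `Re s > 0`, P3 RH). -/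
theorem DiscreteLandau_of (h1 : Sig.stub_cellDrop) (h2 : Sig.stub_cellBudget) (h3 : Sig.stub_slackMellin)
    (h4 : Sig.stub_landauPush) (h5 : Sig.stub_unshift) (h6 : Sig.stub_xiContinuation)
    (h7 : Sig.stub_rh_of_continuation) :
    Summit.RiemannHypothesis.RiemannHypothesis.Theses.IntegerScrew.DiscreteLandau := by
  have hP1 : ScrewNodeInterpolation := ScrewNodeInterpolation_of h1 h2
  have hP2 : ScrewLaplaceAbscissa := ScrewLaplaceAbscissa_of h3 h4 h5
  have hP3 : ScrewLaplaceDetection := ScrewLaplaceDetection_of h6 h7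
  intro hm
  obtain ⟨K, hK⟩ := hP1
  refine hP3 (hP2 ⟨K, fun t ht => ?_⟩)
  have hfloor : 1 ≤ ⌊Real.exp t⌋₊ := (Nat.one_le_floor_iff _).2 (Real.one_le_exp ht)
  have hnode := hm _ hfloor
  have hint := hK t ht
  linarith

/-- The crux modulo exactly the seven `stub_*` sorries (audit: sorries only inside `stub_*`). -/
theorem discreteLandau :
    Summit.RiemannHypothesis.RiemannHypothesis.Theses.IntegerScrew.DiscreteLandau :=
  DiscreteLandau_of stub_cellDrop stub_cellBudget stub_slackMellin stub_landauPush stub_unshift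
    stub_xiContinuation stub_rh_of_continuation

end Summit.RiemannHypothesis.RiemannHypothesis.Cruxes.DiscreteLandau.SplitLandau
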